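import Literature.AlgebraicGeometry.Modules.CechSectionsCochainDictionary
import Literature.AlgebraicGeometry.Modules.CechUnitModuleHZeroScalars
import Literature.Algebra.Homology.OrderedCechSystemRefineMap
import Literature.Algebra.Homology.OrderedCechSystemFullRefine
import Literature.Algebra.Homology.CochainMapHomologyElementwise
import HarnessLib

/-!
# A scaling identity between two refinement maps on ordered Čech CLASSES forces a FULL coboundary
# (The Stacks Project, Tags 01FG, 01FM; Görtz–Wedhorn II, Thm. 22.9)

Layer `Literature/AlgebraicGeometry/Modules`; namespaces `Literature.Algebra.Homology.OrderedCech` (§1, pure homological algebra),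
`Literature.Algebra.Homology.OrderedCech.Full` (§2, full cochains) and `Literature.AlgebraicGeometry.Modules` (§3).  PROOF file
(theorems only: no definition, no instance, no notation, no named fact, no `sorry`).  Cell `hodgecm-mathlib` FLOOR 0, P1 sub-line F-11,
MONO-G1 slot (5) `hrel₃` («`[2]^* = 4` on `Ȟ²(𝒪)`»), road N1–N4 of F0P1b-p01 (g2) ∕ F0P1b-p04 (g2) (F0P1b-plan (g2) (R109)): this is
the step (S5)+(S6) of the N4 assembly — from the ORDERED class identity to FULL cochains — generic in the schemes, the modules and
the index maps.  HC_CM is proved only modulo the 7 printed citations until rung 0 closes — nothing here bears on a summit statement.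

For systems `M`, `M′` of modules and two cochain maps `F, G : Č(M) ⟶ Č(M′)` of ordered Čech complexes (★ `OrderedCech.sysComplex`):
* §1 **`OrderedCech.exists_d_eq_of_homologyMap_eq_smul`** — if `Hᴺ(F) x = c • Hᴺ(G) x` for every class `x`, then for every
  `N`-cocycle `y`, `F y − c • G y = d γ` is a coboundary (★ `HomologyElementwise.exists_d_eq_iCycles_of_homologyπ_eq_zero`);
* §2 `Full.d_pullbackCochain` (★ `Full.pullback` is a cochain map, on cochains), `Full.res_sub_ext_res`, `Full.d_sub_ext_res`
  (`c − ext (res c)` is a full cocycle vanishing on increasing tuples, for a full cocycle `c`);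
* §3 **`Modules.exists_full_d_eq_pullbackCochain_sub_smul`** — for finite covers `𝓤` of `X`, `𝓥` of `Y` with affine non-empty finite
  intersections, affine-localizing modules `L`, `L′`, base-ring structures `ρ`, `ρ′`, index maps `θ₁, θ₂ : 𝓥 → 𝓤` with comparison data
  `φ₁, φ₂` (★ `OrderedCech.refineComplexMap`), and `c₀ ∈ A`: if `H²(θ₁^♯) x = c₀ • H²(θ₂^♯) x` on all of `Ȟ²(𝓤, L)`, then for every FULL
  `2`-cocycle `c` of `L` on `𝓤` the full cochain `Θ_{θ₁} c − c₀ • Θ_{θ₂} c` (★ `Full.pullbackCochain`) is a full COBOUNDARY on `𝓥`.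
  Proof: `c = ext (res c) + d w` (Leray on `𝓤`, ★ `Full.exists_d_eq_of_res_eq_sysD`), `res ∘ Θ ∘ ext = θ^♯` (★ `Full.res_pullbackCochain_ext`),
  §1 on `res c`, Leray on `𝓥`.

Mathlib searched (pin v4.32): `HomologicalComplex.homologyπ_naturality`, `HomologicalComplex.cyclesMap_i`, `HomologicalComplex.Hom.comm`
(used); Mathlib has no Čech complexes of sheaves of modules on schemes.

## References
* The Stacks Project, Tag 01FG (Čech complex, refinement along a map of coverings), Tag 01FM (alternating ∕ ordered complex),
  Tag 01XD (Čech cohomology of quasi-coherent modules on affine covers). [StacksProject]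
* U. Görtz, T. Wedhorn, *Algebraic Geometry II: Cohomology of Schemes* (2023), Def. 21.64, Def. 21.68, Thm. 22.9 (p. 236). [GortzWedhorn2023]
* C. Weibel, *An introduction to homological algebra* (1994), §1.1 (Def. 1.1.1). [Weibel1994]
-/

noncomputable section

set_option backward.isDefEq.respectTransparency false

open CategoryTheory CategoryTheory.Limits AlgebraicGeometry TopologicalSpace Opposite
open Literature.Algebra.Homology

universe u

/-! ## §1 Class identities of the ordered complex, read on cochains -/

namespace Literature.Algebra.Homology.OrderedCech

variable {A : Type u} [CommRing A] {ι ι' : Type} [LinearOrder ι] [LinearOrder ι']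
  {M : Finset ι ⥤ ModuleCat.{u} A} {M' : Finset ι' ⥤ ModuleCat.{u} A}

/-- **A class identity `H(F) x = c • H(G) x` on all of `Hᴺ`, read on a cocycle**: for cochain maps `F, G` of ordered Čech
complexes and an `N`-cocycle `y`, `F y − c • G y` is a coboundary `d γ`. [cite: Weibel1994, §1.1 (Def. 1.1.1)] -/
theorem exists_d_eq_of_homologyMap_eq_smul (F G : sysComplex M ⟶ sysComplex M') (c : A) (N : ℤ)
    (h : ∀ x : (sysComplex M).homology N,
      (HomologicalComplex.homologyMap F N).hom x = c • (HomologicalComplex.homologyMap G N).hom x)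
    (y : SysCochain M N) (hy : sysD M N y = 0) :
    ∃ γ : (sysComplex M').X (N - 1), (F.f N).hom y - c • (G.f N).hom y = ((sysComplex M').d (N - 1) N).hom γ := by
  obtain ⟨ζ, hζ⟩ := Literature.AlgebraicGeometry.Modules.exists_cycles_eq M N y hy
  -- the cycle `F ζ - c • G ζ` has class zero
  have hcls : ((sysComplex M').homologyπ N).hom
      ((HomologicalComplex.cyclesMap F N).hom ζ - c • (HomologicalComplex.cyclesMap G N).hom ζ) = 0 := by
    rw [map_sub, map_smul]
    have eF : ((sysComplex M').homologyπ N).hom ((HomologicalComplex.cyclesMap F N).hom ζ) =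
        (HomologicalComplex.homologyMap F N).hom (((sysComplex M).homologyπ N).hom ζ) := by
      rw [← ModuleCat.comp_apply, ← ModuleCat.comp_apply, HomologicalComplex.homologyπ_naturality F N]
    have eG : ((sysComplex M').homologyπ N).hom ((HomologicalComplex.cyclesMap G N).hom ζ) =
        (HomologicalComplex.homologyMap G N).hom (((sysComplex M).homologyπ N).hom ζ) := by
      rw [← ModuleCat.comp_apply, ← ModuleCat.comp_apply, HomologicalComplex.homologyπ_naturality G N]
    rw [eF, eG, h, sub_self]
  obtain ⟨γ, hγ⟩ := HomologyElementwise.exists_d_eq_iCycles_of_homologyπ_eq_zero (sysComplex M') N _ hcls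
  refine ⟨γ, ?_⟩
  rw [hγ, map_sub, map_smul]
  have iF : ((sysComplex M').iCycles N).hom ((HomologicalComplex.cyclesMap F N).hom ζ) = (F.f N).hom y := by
    rw [← ModuleCat.comp_apply, HomologicalComplex.cyclesMap_i, ModuleCat.comp_apply, hζ]
  have iG : ((sysComplex M').iCycles N).hom ((HomologicalComplex.cyclesMap G N).hom ζ) = (G.f N).hom y := by
    rw [← ModuleCat.comp_apply, HomologicalComplex.cyclesMap_i, ModuleCat.comp_apply, hζ]
  rw [iF, iG]

end Literature.Algebra.Homology.OrderedCech

/-! ## §2 Full cochains: the pull-back is a cochain map; `c − ext (res c)` -/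

namespace Literature.Algebra.Homology.OrderedCech.Full

variable {ι ι' : Type} [LinearOrder ι] [LinearOrder ι'] {A : Type u} [CommRing A]
  {M : Finset ι ⥤ ModuleCat.{u} A} {M' : Finset ι' ⥤ ModuleCat.{u} A} (θ : ι' → ι) (φ : imageFunctor θ ⋙ M ⟶ M')

/-- **The pull-back of full cochains commutes with the full differentials** (★ `Full.pullback` is a cochain map).
[cite: StacksProject, Tag 01FG] -/
theorem d_pullbackCochain (n : ℕ) (c : Cochain M n) :
    ((complex M').d n (n + 1)).hom (pullbackCochain θ φ n c) = pullbackCochain θ φ (n + 1) (((complex M).d n (n + 1)).hom c) := by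
  have h := congrArg (fun F => F.hom c) ((pullback θ φ).comm n (n + 1))
  simp only [pullback_f, ModuleCat.hom_comp, LinearMap.coe_comp, Function.comp_apply, ModuleCat.hom_ofHom] at h
  exact h

variable (M) in
/-- `res (c − ext (res c)) = 0`: a full cochain minus the alternating extension of its restriction vanishes on increasing
tuples. [cite: StacksProject, Tag 01FM] -/
theorem res_sub_ext_res (n : ℕ) (c : Cochain M n) : res M n (c - ext M n (res M n c)) = 0 := by
  rw [map_sub, res_ext, sub_self]

variable (M) in
/-- `d (c − ext (res c)) = 0` for a full cocycle `c`. [cite: StacksProject, Tag 01FM] -/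
theorem d_sub_ext_res (n : ℕ) (c : Cochain M n) (hc : ((complex M).d n (n + 1)).hom c = 0) :
    ((complex M).d n (n + 1)).hom (c - ext M n (res M n c)) = 0 := by
  rw [map_sub, hc, d_ext, sysD_res, hc, map_zero, map_zero, sub_zero]

end Literature.Algebra.Homology.OrderedCech.Full

/-! ## §3 From the ordered class identity to a full coboundary -/

namespace Literature.AlgebraicGeometry.Modules

variable {X Y : Scheme.{0}} {ι ι' : Type} [LinearOrder ι] [LinearOrder ι'] [Fintype ι] [Fintype ι']
  (U : ι → X.Opens) (V : ι' → Y.Opens) (L : X.Modules) (L' : Y.Modules) {A : Type} [CommRing A]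
  (ρ : A →+* Γ(X, ⊤)) (ρ' : A →+* Γ(Y, ⊤))
  (hUa : ∀ s : Finset ι, s.Nonempty → IsAffineOpen (cechOpen U s)) (hUcov : ⨆ i, U i = ⊤) (hL : IsAffineLocalizing L)
  (hVa : ∀ s : Finset ι', s.Nonempty → IsAffineOpen (cechOpen V s)) (hVcov : ⨆ i, V i = ⊤) (hL' : IsAffineLocalizing L')
  (θ₁ θ₂ : ι' → ι) (φ₁ : OrderedCech.imageFunctor θ₁ ⋙ sectionsSystem U L ρ ⟶ sectionsSystem V L' ρ')
  (φ₂ : OrderedCech.imageFunctor θ₂ ⋙ sectionsSystem U L ρ ⟶ sectionsSystem V L' ρ') (c₀ : A)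

include hUa hUcov hL hVa hVcov hL' in
/-- **From the ordered class identity `H(θ₁^♯) x = c₀ • H(θ₂^♯) x` on `Ȟ²(𝓤, L)` to full cochains**: for every FULL `2`-cocycle
`c` of `L` on `𝓤`, `Θ_{θ₁} c − c₀ • Θ_{θ₂} c` is a full coboundary on `𝓥` (both covers finite with affine finite intersections,
`L`, `L′` affine-localizing) — `c = ext (res c) + d w` by Leray on `𝓤` (★ `Full.exists_d_eq_of_res_eq_sysD`), `res ∘ Θ ∘ ext = θ^♯`
(★ `Full.res_pullbackCochain_ext`), then Leray on `𝓥`. [cite: StacksProject, Tag 01FM] [cite: GortzWedhorn2023, Thm. 22.9 (p. 236)] -/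
theorem exists_full_d_eq_pullbackCochain_sub_smul
    (hOrd : ∀ x : (cechComplex U L ρ).homology 2,
      (HomologicalComplex.homologyMap (OrderedCech.refineComplexMap θ₁ φ₁) 2).hom x =
        c₀ • (HomologicalComplex.homologyMap (OrderedCech.refineComplexMap θ₂ φ₂) 2).hom x)
    (c : OrderedCech.Full.Cochain (sectionsSystem U L ρ) 2)
    (hc : ((OrderedCech.Full.complex (sectionsSystem U L ρ)).d 2 3).hom c = 0) :
    ∃ w : OrderedCech.Full.Cochain (sectionsSystem V L' ρ') 1,
      ((OrderedCech.Full.complex (sectionsSystem V L' ρ')).d 1 2).hom w =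
        OrderedCech.Full.pullbackCochain θ₁ φ₁ 2 c - c₀ • OrderedCech.Full.pullbackCochain θ₂ φ₂ 2 c := by
  -- the alternating part `y = res c` is an ordered `2`-cocycle
  have hdy : OrderedCech.sysD (sectionsSystem U L ρ) 2 (OrderedCech.Full.res (sectionsSystem U L ρ) 2 c) = 0 := by
    have h := OrderedCech.Full.sysD_res (sectionsSystem U L ρ) 2 c
    have hc' : ((OrderedCech.Full.complex (sectionsSystem U L ρ)).d 2 (2 + 1)).hom c = 0 := hc
    rw [hc', map_zero] at h
    exact h
  -- (S5) the class identity on cochains: `θ₁^♯ y − c₀ • θ₂^♯ y = sysD γ`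
  obtain ⟨γ, hγ⟩ := OrderedCech.exists_d_eq_of_homologyMap_eq_smul
    (OrderedCech.refineComplexMap θ₁ φ₁) (OrderedCech.refineComplexMap θ₂ φ₂) c₀ 2 hOrd
    (OrderedCech.Full.res (sectionsSystem U L ρ) 2 c) hdy
  have hγ' : OrderedCech.refineCochain θ₁ φ₁ 2 (OrderedCech.Full.res (sectionsSystem U L ρ) 2 c) -
      c₀ • OrderedCech.refineCochain θ₂ φ₂ 2 (OrderedCech.Full.res (sectionsSystem U L ρ) 2 c) =
        OrderedCech.sysD (sectionsSystem V L' ρ') 1 γ := by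
    have e : ((OrderedCech.sysComplex (sectionsSystem V L' ρ')).d (2 - 1) 2).hom γ = OrderedCech.sysD (sectionsSystem V L' ρ') 1 γ := by
      change ((OrderedCech.sysComplex (sectionsSystem V L' ρ')).d 1 (1 + 1)).hom γ = _
      rw [OrderedCech.sysComplex_d]
      rfl
    rw [← e, ← hγ]
    rfl
  -- `c = ext (res c) + d w` on `𝓤` (Leray on `𝓤`)
  obtain ⟨w, hw⟩ := OrderedCech.Full.exists_d_eq_of_res_eq_sysD U L ρ hUa hUcov hL 1
    (c - OrderedCech.Full.ext (sectionsSystem U L ρ) 2 (OrderedCech.Full.res (sectionsSystem U L ρ) 2 c))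
    (OrderedCech.Full.d_sub_ext_res (sectionsSystem U L ρ) 2 c hc) 0
    (by rw [map_zero]; exact OrderedCech.Full.res_sub_ext_res (sectionsSystem U L ρ) 2 c)
  have hcdec : c = OrderedCech.Full.ext (sectionsSystem U L ρ) 2 (OrderedCech.Full.res (sectionsSystem U L ρ) 2 c) +
      (show OrderedCech.Full.Cochain (sectionsSystem U L ρ) 2 from
        ((OrderedCech.Full.complex (sectionsSystem U L ρ)).d 1 2).hom w) := by
    have hw' : (show OrderedCech.Full.Cochain (sectionsSystem U L ρ) 2 from
        ((OrderedCech.Full.complex (sectionsSystem U L ρ)).d 1 2).hom w) = c - _ := hw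
    rw [hw']; abel
  -- the images of the two summands under `Θ₁`, `Θ₂`, restricted to increasing tuples
  have hΘd : ∀ (θ : ι' → ι) (φ : OrderedCech.imageFunctor θ ⋙ sectionsSystem U L ρ ⟶ sectionsSystem V L' ρ'),
      OrderedCech.Full.res (sectionsSystem V L' ρ') 2 (OrderedCech.Full.pullbackCochain θ φ 2
        (show OrderedCech.Full.Cochain (sectionsSystem U L ρ) 2 from
          ((OrderedCech.Full.complex (sectionsSystem U L ρ)).d 1 2).hom w)) =
        OrderedCech.sysD (sectionsSystem V L' ρ') 1
          (OrderedCech.Full.res (sectionsSystem V L' ρ') 1 (OrderedCech.Full.pullbackCochain θ φ 1 w)) := by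
    intro θ φ
    have h1 := OrderedCech.Full.d_pullbackCochain θ φ 1 w
    have h2 := OrderedCech.Full.sysD_res (sectionsSystem V L' ρ') 1 (OrderedCech.Full.pullbackCochain θ φ 1 w)
    rw [h1] at h2
    exact h2.symm
  have hΘe : ∀ (θ : ι' → ι) (φ : OrderedCech.imageFunctor θ ⋙ sectionsSystem U L ρ ⟶ sectionsSystem V L' ρ'),
      OrderedCech.Full.res (sectionsSystem V L' ρ') 2 (OrderedCech.Full.pullbackCochain θ φ 2
        (OrderedCech.Full.ext (sectionsSystem U L ρ) 2 (OrderedCech.Full.res (sectionsSystem U L ρ) 2 c))) =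
        OrderedCech.refineCochain θ φ 2 (OrderedCech.Full.res (sectionsSystem U L ρ) 2 c) :=
    fun θ φ => OrderedCech.Full.res_pullbackCochain_ext θ φ 2 _
  -- the full cochain `Y := Θ₁ c - c₀ • Θ₂ c` on `𝓥` is a cocycle whose restriction is an ordered coboundary
  have hdY : ((OrderedCech.Full.complex (sectionsSystem V L' ρ')).d (1 + 1) (1 + 2)).hom
      (OrderedCech.Full.pullbackCochain θ₁ φ₁ 2 c - c₀ • OrderedCech.Full.pullbackCochain θ₂ φ₂ 2 c) = 0 := by
    have hc' : ((OrderedCech.Full.complex (sectionsSystem U L ρ)).d 2 (2 + 1)).hom c = 0 := hc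
    change ((OrderedCech.Full.complex (sectionsSystem V L' ρ')).d 2 (2 + 1)).hom _ = 0
    rw [map_sub, map_smul, OrderedCech.Full.d_pullbackCochain, OrderedCech.Full.d_pullbackCochain, hc', map_zero,
      map_zero, smul_zero, sub_zero]
  have hresY : OrderedCech.Full.res (sectionsSystem V L' ρ') (1 + 1)
      (OrderedCech.Full.pullbackCochain θ₁ φ₁ 2 c - c₀ • OrderedCech.Full.pullbackCochain θ₂ φ₂ 2 c) =
      OrderedCech.sysD (sectionsSystem V L' ρ') 1
        ((show OrderedCech.SysCochain (sectionsSystem V L' ρ') 1 from γ) +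
          (OrderedCech.Full.res (sectionsSystem V L' ρ') 1 (OrderedCech.Full.pullbackCochain θ₁ φ₁ 1 w) -
          c₀ • OrderedCech.Full.res (sectionsSystem V L' ρ') 1 (OrderedCech.Full.pullbackCochain θ₂ φ₂ 1 w))) := by
    change OrderedCech.Full.res (sectionsSystem V L' ρ') 2 _ = _
    rw [map_sub, map_smul]
    conv_lhs => rw [hcdec]
    rw [map_add, map_add, map_add, map_add, hΘd, hΘd, hΘe, hΘe, map_add, map_sub, map_smul, ← hγ']
    rw [smul_add]
    abel
  obtain ⟨w', hw'⟩ := OrderedCech.Full.exists_d_eq_of_res_eq_sysD V L' ρ' hVa hVcov hL' 1 _ hdY _ hresY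
  exact ⟨w', hw'⟩

end Literature.AlgebraicGeometry.Modules


end
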